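import Summits.CriticalPhenomena.PercolationContinuityZ3.Theorems.PercNearOneGluingNoHeavyLowerTailQuantitativeGenPeelIdentity
import Summits.CriticalPhenomena.PercolationContinuityZ3.Theorems.PercNearOneGluingNoHeavyLowerTailQuantitativeBHKVertexFunStrict
import Summits.CriticalPhenomena.PercolationContinuityZ3.Theorems.PercNearOneGluingNoHeavyLowerTailQuantitativeS5FloorCompleteGeneral
import Summits.CriticalPhenomena.PercolationContinuityZ3.Theorems.PercNearOneGluingNoHeavyConstsMDLXJointImpliesMDLX
import HarnessLib

/-!
# The ZERO SET of the master form (GEN) `Sur_o(A) ≥ 0` for EVERY monotone functional, and its three explicit strictness certificates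

Support file (`--supports stmt-CriticalPhenomena-4575`), prover seat `prim-rate-mine-2` (lane prim-rate, constants-miner (c), BENCH row
M2-R43; `run/shared/lean/prim/prim-rate/prim-rate-mine-2/PROOFS.md` §P42–§P44).  No definitions, no named facts, no sorries; standard axioms.

(GEN) (`AGloc.gen_firstRank_of_surplusTransfer`, Kozma–Nitzan's Conj. 4 shape, what (AG-loc) and the crux `AdditiveGluing` consume) is the third
and last inequality of block (A) of the `θ(p_c) = 0` chain; rows M2-R19/M2-R36 and M2-R24/M2-R29/M2-R41 located the zeros of the first two (CSH
and (S5)).  By the GEN peeling identity `CSH.surplus_peel_top`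
  `μ(D_k)·Sur_o(A) = μ(D_k)·s5dMargin w T r [] o k F + covD w k T F̂_k o + γ_k·μ(D_k ∩ {o ↔ k})`   (`k` = top relay, `T = A ∖ k`),
the master form is a sum of three NONNEGATIVE pieces with known loci.  Weights `0` off the support `E`, in `(0,1)` on `E`; `A` with an injective
rank `r` compatible with the means of the monotone `F ≥ 0`; `k` its top relay; observer `o ∉ A`:

* `CSH.surplus_nonneg_of_support` — (GEN) re-derived on support-restricted weights from the three pieces;
* `CSH.surplus_pos_iff_three` / `CSH.surplus_eq_zero_iff_three` — **`Sur_o(A) = 0 ⟺ s5dMargin(T; o, k) = 0 ∧ (μ(k ↮ T, o ↔ k) = 0 ∨ γ_k = 0)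
  ∧ covD(F̂_k; o ∣ k ↮ T) = 0`**;
* `CSH.surplus_pos_iff_certificates` (preconnected support, `|A| ≥ 2`) — **`0 < Sur_o(A)` iff ONE OF THREE EXPLICIT CERTIFICATES holds: (i) the
  explicit (S5) floor `FLOOR_F(r'; T, o, k)` of row M2-R21 is positive at some compatible injective rank `r'` of `T` (row M2-R41); (ii) `o ⇝ k`
  off `T` with positive probability and the top relay has a positive rank gain; (iii) a pair of `E` missing `T` is jointly pivotal, inside the
  pairs of `E` missing `T`, for `F(C_k)` and `{k ↔ o}` (the strictness locus of vdBHK Thm 1.3, `QuantBHK.condCov_clusterFun_openConn_pos_iff`)**,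
  and `CSH.surplus_eq_zero_iff_certificates` — the GEN ZERO SET in the same currency;
* `CSH.surplus_singleton_pos_iff` — `|A| = 1`: `Sur_o({k}) = Cov(F(C_k), 1{o ∈ C_k})` is positive iff some pair of `E` is jointly pivotal
  (the equality case of Harris' inequality for a monotone vertex functional against a connection).
For `F = 1{b ∈ ·}` this is the EQUALITY LOCUS of the localised union bound (AG-loc) (file `…QuantitativeAGlocEqualityLocus`).
[cite: KozmaNitzan2024, Conj. 4 (p. 32), Lemma 2 (p. 6)] [cite: VandenbergHaggstromKahn2005, Thm. 1.3 (p. 6)] [cite: Harris1960, Lemma 4.1 (p. 16)]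
-/

noncomputable section

namespace Summit.CriticalPhenomena.PercolationContinuityZ3.Theorems

open MeasureTheory Set Literature.Probability.LatticeModels Literature.Probability.Percolation
open scoped Classical
open KNPreFKG

namespace CSH

variable {n : ℕ}

/-- **The three pieces of the master form are nonnegative** (support-restricted non-degenerate weights, compatible injective rank, top relay `k`,
`o ∉ A`, `F` monotone `≥ 0`): `0 ≤ s5dMargin w (A∖k) r [] o k F` (the lane's explicit (S5) floor, row M2-R21), `0 ≤ γ_k` (Lemma κ) and
`0 ≤ covD w k (A∖k) F̂_k o` (vdBHK Thm 1.3). [cite: KozmaNitzan2024, Conj. 4 (p. 32)] [cite: VandenbergHaggstromKahn2005, Thm. 1.3 (p. 6)] -/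
theorem surplus_pieces_nonneg (w : Sym2 (Fin n) → unitInterval) (E : Set (Sym2 (Fin n)))
    (hE0 : ∀ f, f ∉ E → (w f : ℝ) = 0) (hE1 : ∀ f ∈ E, 0 < (w f : ℝ) ∧ (w f : ℝ) < 1)
    (A : Finset (Fin n)) (r : Fin n → ℕ) (hr : Set.InjOn r ↑A) (k : Fin n) (hkA : k ∈ A)
    (o : Fin n) (hoA : o ∉ A)
    (F : Set (Fin n) → ℝ) (hF : ∀ S S' : Set (Fin n), S ⊆ S' → F S ≤ F S') (hF0 : ∀ S : Set (Fin n), 0 ≤ F S)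
    (hcompat : ∀ a ∈ A, ∀ a' ∈ A, r a < r a' →
      ∫ ω, F (openCluster ω a) ∂(prodBernoulli w) ≤ ∫ ω, F (openCluster ω a') ∂(prodBernoulli w)) :
    0 ≤ s5dMargin w (A.erase k) r [] o k F ∧ 0 ≤ rankGain w A r F k ∧
      0 ≤ covD w k (↑(A.erase k) : Set (Fin n)) (fun C => F {a | a = k ∨ ∃ e ∈ C, a ∈ e}) o := by
  have hw : ∀ e, w e < 1 := by
    intro e
    by_cases he : e ∈ E
    · exact_mod_cast (hE1 e he).2
    · have h0 := hE0 e he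
      exact_mod_cast (show (w e : ℝ) < 1 by rw [h0]; norm_num)
  set T : Finset (Fin n) := A.erase k with hT
  have hTA : ∀ a ∈ T, a ∈ A := fun a ha => Finset.mem_of_mem_erase ha
  have hkT : k ∉ T := Finset.notMem_erase k A
  have hoT : o ∉ T := fun h => hoA (hTA o h)
  have hok : o ≠ k := fun h => hoA (h ▸ hkA)
  have hrT : Set.InjOn r ↑T := hr.mono (by intro a ha; exact Finset.mem_of_mem_erase ha)
  have hcompatT : (∀ a ∈ T, ∀ a' ∈ T, r a < r a' →
        ∫ ω, F (openCluster ω a) ∂(prodBernoulli w) ≤ ∫ ω, F (openCluster ω a') ∂(prodBernoulli w)) := fun a ha a' ha' h => hcompat a (hTA a ha) a' (hTA a' ha') h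
  refine ⟨?_, ?_, ?_⟩
  · have hnn := fun a (ha : a ∈ T) => isolatedFloor_term_nonneg w o k T r F hF hF0 hcompatT a ha
    have hfloor := s5dMargin_ge_sum_rankGain_add_isolatedFloor_of_lt_one_of_compat w hw o k hok T r F hF hF0 hrT hcompatT hoT hkT
    exact le_trans (Finset.sum_nonneg fun a ha => add_nonneg (hnn a ha).1 (hnn a ha).2) hfloor
  · exact rankGain_nonneg w A r F k fun a' ha' hlt => hcompat a' ha' k hkA hlt
  · refine Consts.covD_conn_nonneg w k (↑T : Set (Fin n)) (fun h => hkT (Finset.mem_coe.1 h)) (fun C => F {a | a = k ∨ ∃ e ∈ C, a ∈ e}) ?_ o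
    intro C C' hCC'
    refine hF _ _ fun c hc => ?_
    rcases hc with hc | ⟨e, he, hce⟩
    · exact Or.inl hc
    · exact Or.inr ⟨e, hCC' he, hce⟩

/-- **(GEN) on support-restricted weights**, re-derived from the three nonnegative pieces of the peeling identity: `0 ≤ Sur_o(A)`.
[cite: KozmaNitzan2024, Conj. 4 (p. 32)] [cite: VandenbergHaggstromKahn2005, Thm. 1.3 (p. 6)] -/
theorem surplus_nonneg_of_support (w : Sym2 (Fin n) → unitInterval) (E : Set (Sym2 (Fin n)))
    (hE0 : ∀ f, f ∉ E → (w f : ℝ) = 0) (hE1 : ∀ f ∈ E, 0 < (w f : ℝ) ∧ (w f : ℝ) < 1)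
    (A : Finset (Fin n)) (r : Fin n → ℕ) (hr : Set.InjOn r ↑A) (k : Fin n) (hkA : k ∈ A) (hkmax : ∀ a ∈ A, r a ≤ r k)
    (o : Fin n) (hoA : o ∉ A)
    (F : Set (Fin n) → ℝ) (hF : ∀ S S' : Set (Fin n), S ⊆ S' → F S ≤ F S') (hF0 : ∀ S : Set (Fin n), 0 ≤ F S)
    (hcompat : ∀ a ∈ A, ∀ a' ∈ A, r a < r a' →
      ∫ ω, F (openCluster ω a) ∂(prodBernoulli w) ≤ ∫ ω, F (openCluster ω a') ∂(prodBernoulli w)) :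
    0 ≤ surplus w A r F o := by
  have hw : ∀ e, w e < 1 := by
    intro e
    by_cases he : e ∈ E
    · exact_mod_cast (hE1 e he).2
    · have h0 := hE0 e he
      exact_mod_cast (show (w e : ℝ) < 1 by rw [h0]; norm_num)
  obtain ⟨h1, h2, h3⟩ := surplus_pieces_nonneg w E hE0 hE1 A r hr k hkA o hoA F hF hF0 hcompat
  have hid := surplus_peel_top w hw A r F o k hkA hr hkmax
  have hempty : (∅ : BondConfig (Fin n)) ∈ {ω : BondConfig (Fin n) | ∀ a ∈ (↑(A.erase k) : Set (Fin n)), ¬ (openGraph ω).Reachable k a} := by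
    intro a ha h
    rw [HullPort.reachable_empty_iff] at h
    subst h
    exact (Finset.notMem_erase k A) (Finset.mem_coe.1 ha)
  have hDpos : 0 < (prodBernoulli w).real {ω : BondConfig (Fin n) | ∀ a ∈ (↑(A.erase k) : Set (Fin n)), ¬ (openGraph ω).Reachable k a} := prodBernoulli_real_pos_of_empty_mem w hw hempty
  have h4 : 0 ≤ rankGain w A r F k * (prodBernoulli w).real ({ω : BondConfig (Fin n) | ∀ a ∈ (↑(A.erase k) : Set (Fin n)), ¬ (openGraph ω).Reachable k a} ∩ openConn o k) := mul_nonneg h2 measureReal_nonneg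
  have h5 : 0 ≤ (prodBernoulli w).real {ω : BondConfig (Fin n) | ∀ a ∈ (↑(A.erase k) : Set (Fin n)), ¬ (openGraph ω).Reachable k a} * surplus w A r F o := by
    rw [hid]; exact add_nonneg (add_nonneg (mul_nonneg hDpos.le h1) h3) h4
  rcases lt_or_ge (surplus w A r F o) 0 with hlt | hge
  · have := mul_neg_of_pos_of_neg hDpos hlt
    linarith
  · exact hge

/-- **`0 < Sur_o(A)` iff one of the three pieces is positive**: the (S5) margin of `(A∖k; o, k)`, or (`o ↔ k` off `A∖k` with positive
probability and) the rank gain of the top relay, or the conditional covariance `covD(F̂_k; o ∣ k ↮ A∖k)`.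
[cite: KozmaNitzan2024, Conj. 4 (p. 32)] [cite: VandenbergHaggstromKahn2005, Thm. 1.3 (p. 6)] -/
theorem surplus_pos_iff_three (w : Sym2 (Fin n) → unitInterval) (E : Set (Sym2 (Fin n)))
    (hE0 : ∀ f, f ∉ E → (w f : ℝ) = 0) (hE1 : ∀ f ∈ E, 0 < (w f : ℝ) ∧ (w f : ℝ) < 1)
    (A : Finset (Fin n)) (r : Fin n → ℕ) (hr : Set.InjOn r ↑A) (k : Fin n) (hkA : k ∈ A) (hkmax : ∀ a ∈ A, r a ≤ r k)
    (o : Fin n) (hoA : o ∉ A)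
    (F : Set (Fin n) → ℝ) (hF : ∀ S S' : Set (Fin n), S ⊆ S' → F S ≤ F S') (hF0 : ∀ S : Set (Fin n), 0 ≤ F S)
    (hcompat : ∀ a ∈ A, ∀ a' ∈ A, r a < r a' →
      ∫ ω, F (openCluster ω a) ∂(prodBernoulli w) ≤ ∫ ω, F (openCluster ω a') ∂(prodBernoulli w)) :
    0 < surplus w A r F o ↔
      0 < s5dMargin w (A.erase k) r [] o k F ∨
        (0 < (prodBernoulli w).real ({ω : BondConfig (Fin n) | ∀ a ∈ (↑(A.erase k) : Set (Fin n)), ¬ (openGraph ω).Reachable k a} ∩ openConn o k) ∧ 0 < rankGain w A r F k) ∨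
        0 < covD w k (↑(A.erase k) : Set (Fin n)) (fun C => F {a | a = k ∨ ∃ e ∈ C, a ∈ e}) o := by
  have hw : ∀ e, w e < 1 := by
    intro e
    by_cases he : e ∈ E
    · exact_mod_cast (hE1 e he).2
    · have h0 := hE0 e he
      exact_mod_cast (show (w e : ℝ) < 1 by rw [h0]; norm_num)
  obtain ⟨h1, h2, h3⟩ := surplus_pieces_nonneg w E hE0 hE1 A r hr k hkA o hoA F hF hF0 hcompat
  have hid := surplus_peel_top w hw A r F o k hkA hr hkmax
  have hempty : (∅ : BondConfig (Fin n)) ∈ {ω : BondConfig (Fin n) | ∀ a ∈ (↑(A.erase k) : Set (Fin n)), ¬ (openGraph ω).Reachable k a} := by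
    intro a ha h
    rw [HullPort.reachable_empty_iff] at h
    subst h
    exact (Finset.notMem_erase k A) (Finset.mem_coe.1 ha)
  have hDpos : 0 < (prodBernoulli w).real {ω : BondConfig (Fin n) | ∀ a ∈ (↑(A.erase k) : Set (Fin n)), ¬ (openGraph ω).Reachable k a} := prodBernoulli_real_pos_of_empty_mem w hw hempty
  have hPn : 0 ≤ (prodBernoulli w).real ({ω : BondConfig (Fin n) | ∀ a ∈ (↑(A.erase k) : Set (Fin n)), ¬ (openGraph ω).Reachable k a} ∩ openConn o k) := measureReal_nonneg
  constructor
  · intro hpos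
    have hL : 0 < (prodBernoulli w).real {ω : BondConfig (Fin n) | ∀ a ∈ (↑(A.erase k) : Set (Fin n)), ¬ (openGraph ω).Reachable k a} * surplus w A r F o := mul_pos hDpos hpos
    rw [hid] at hL
    by_contra H
    push Not at H
    obtain ⟨H1, H2, H3⟩ := H
    have e1 : s5dMargin w (A.erase k) r [] o k F = 0 := le_antisymm H1 h1
    have e3 : covD w k (↑(A.erase k) : Set (Fin n)) (fun C => F {a | a = k ∨ ∃ e ∈ C, a ∈ e}) o = 0 := le_antisymm H3 h3
    have e2 : rankGain w A r F k * (prodBernoulli w).real ({ω : BondConfig (Fin n) | ∀ a ∈ (↑(A.erase k) : Set (Fin n)), ¬ (openGraph ω).Reachable k a} ∩ openConn o k) = 0 := by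
      rcases hPn.lt_or_eq with hP | hP
      · rw [le_antisymm (H2 hP) h2, zero_mul]
      · rw [← hP, mul_zero]
    rw [e1, e3, e2] at hL
    simp at hL
  · intro H
    have hL : 0 < (prodBernoulli w).real {ω : BondConfig (Fin n) | ∀ a ∈ (↑(A.erase k) : Set (Fin n)), ¬ (openGraph ω).Reachable k a} * s5dMargin w (A.erase k) r [] o k F +
        covD w k (↑(A.erase k) : Set (Fin n)) (fun C => F {a | a = k ∨ ∃ e ∈ C, a ∈ e}) o +
        rankGain w A r F k * (prodBernoulli w).real ({ω : BondConfig (Fin n) | ∀ a ∈ (↑(A.erase k) : Set (Fin n)), ¬ (openGraph ω).Reachable k a} ∩ openConn o k) := by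
      rcases H with H1 | ⟨HP, H2⟩ | H3
      · have := mul_pos hDpos H1
        nlinarith [mul_nonneg h2 hPn]
      · have := mul_pos H2 HP
        nlinarith [mul_nonneg hDpos.le h1]
      · nlinarith [mul_nonneg hDpos.le h1, mul_nonneg h2 hPn]
    rw [← hid] at hL
    exact pos_of_mul_pos_right hL hDpos.le

/-- **The GEN zero set in three pieces**: `Sur_o(A) = 0 ⟺ s5dMargin(A∖k; o, k) = 0 ∧ (μ(k ↮ A∖k, o ↔ k) = 0 ∨ γ_k = 0) ∧ covD = 0`.
[cite: KozmaNitzan2024, Conj. 4 (p. 32)] [cite: VandenbergHaggstromKahn2005, Thm. 1.3 (p. 6)] -/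
theorem surplus_eq_zero_iff_three (w : Sym2 (Fin n) → unitInterval) (E : Set (Sym2 (Fin n)))
    (hE0 : ∀ f, f ∉ E → (w f : ℝ) = 0) (hE1 : ∀ f ∈ E, 0 < (w f : ℝ) ∧ (w f : ℝ) < 1)
    (A : Finset (Fin n)) (r : Fin n → ℕ) (hr : Set.InjOn r ↑A) (k : Fin n) (hkA : k ∈ A) (hkmax : ∀ a ∈ A, r a ≤ r k)
    (o : Fin n) (hoA : o ∉ A)
    (F : Set (Fin n) → ℝ) (hF : ∀ S S' : Set (Fin n), S ⊆ S' → F S ≤ F S') (hF0 : ∀ S : Set (Fin n), 0 ≤ F S)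
    (hcompat : ∀ a ∈ A, ∀ a' ∈ A, r a < r a' →
      ∫ ω, F (openCluster ω a) ∂(prodBernoulli w) ≤ ∫ ω, F (openCluster ω a') ∂(prodBernoulli w)) :
    surplus w A r F o = 0 ↔
      s5dMargin w (A.erase k) r [] o k F = 0 ∧
        ((prodBernoulli w).real ({ω : BondConfig (Fin n) | ∀ a ∈ (↑(A.erase k) : Set (Fin n)), ¬ (openGraph ω).Reachable k a} ∩ openConn o k) = 0 ∨ rankGain w A r F k = 0) ∧
        covD w k (↑(A.erase k) : Set (Fin n)) (fun C => F {a | a = k ∨ ∃ e ∈ C, a ∈ e}) o = 0 := by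
  obtain ⟨h1, h2, h3⟩ := surplus_pieces_nonneg w E hE0 hE1 A r hr k hkA o hoA F hF hF0 hcompat
  have h0 := surplus_nonneg_of_support w E hE0 hE1 A r hr k hkA hkmax o hoA F hF hF0 hcompat
  have hiff := surplus_pos_iff_three w E hE0 hE1 A r hr k hkA hkmax o hoA F hF hF0 hcompat
  have hPn : 0 ≤ (prodBernoulli w).real ({ω : BondConfig (Fin n) | ∀ a ∈ (↑(A.erase k) : Set (Fin n)), ¬ (openGraph ω).Reachable k a} ∩ openConn o k) := measureReal_nonneg
  constructor
  · intro hz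
    have hn : ¬ 0 < surplus w A r F o := by rw [hz]; exact lt_irrefl 0
    rw [hiff] at hn
    push Not at hn
    obtain ⟨H1, H2, H3⟩ := hn
    refine ⟨le_antisymm H1 h1, ?_, le_antisymm H3 h3⟩
    rcases hPn.lt_or_eq with hP | hP
    · exact Or.inr (le_antisymm (H2 hP) h2)
    · exact Or.inl hP.symm
  · rintro ⟨H1, H2, H3⟩
    rcases h0.lt_or_eq with hpos | hz
    · rw [hiff] at hpos
      rcases hpos with H | ⟨HP, HG⟩ | H
      · rw [H1] at H; exact absurd H (lt_irrefl 0)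
      · rcases H2 with H2 | H2
        · rw [H2] at HP; exact absurd HP (lt_irrefl 0)
        · rw [H2] at HG; exact absurd HG (lt_irrefl 0)
      · rw [H3] at H; exact absurd H (lt_irrefl 0)
    · exact hz.symm

/-- **`0 < Sur_o(A)` iff one of three EXPLICIT CERTIFICATES** (preconnected non-degenerate support, `|A| ≥ 2`, compatible injective rank, top relay
`k`, `T = A∖k`, `o ∉ A`, `F` monotone `≥ 0`): (i) the explicit (S5) floor `FLOOR_F(r'; T, o, k)` is positive at some compatible injective rank
`r'` of `T`; or (ii) `μ(k ↮ T, o ↔ k) > 0` and `γ_k > 0`; or (iii) some pair of `E` missing `T` is jointly pivotal inside the pairs of `E`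
missing `T` for `F(C_k)` and `{k ↔ o}`.  Rows M2-R41 + M2-R44 + the GEN peeling identity.
[cite: KozmaNitzan2024, Conj. 4 (p. 32)] [cite: VandenbergHaggstromKahn2005, Thm. 1.3 (p. 6)] [cite: Harris1960, Lemma 4.1 (p. 16)] -/
theorem surplus_pos_iff_certificates (w : Sym2 (Fin n) → unitInterval) (E : Set (Sym2 (Fin n)))
    (hE0 : ∀ f, f ∉ E → (w f : ℝ) = 0) (hE1 : ∀ f ∈ E, 0 < (w f : ℝ) ∧ (w f : ℝ) < 1)
    (A : Finset (Fin n)) (r : Fin n → ℕ) (hr : Set.InjOn r ↑A) (k : Fin n) (hkA : k ∈ A) (hkmax : ∀ a ∈ A, r a ≤ r k)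
    (o : Fin n) (hoA : o ∉ A)
    (F : Set (Fin n) → ℝ) (hF : ∀ S S' : Set (Fin n), S ⊆ S' → F S ≤ F S') (hF0 : ∀ S : Set (Fin n), 0 ≤ F S)
    (hcompat : ∀ a ∈ A, ∀ a' ∈ A, r a < r a' →
      ∫ ω, F (openCluster ω a) ∂(prodBernoulli w) ≤ ∫ ω, F (openCluster ω a') ∂(prodBernoulli w))
    (hconn : (openGraph E).Preconnected) (hT : (A.erase k).Nonempty) :
    0 < surplus w A r F o ↔
      (∃ r' : Fin n → ℕ, Set.InjOn r' ↑(A.erase k) ∧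
        (∀ a ∈ (A.erase k), ∀ a' ∈ (A.erase k), r' a < r' a' →
        ∫ ω, F (openCluster ω a) ∂(prodBernoulli w) ≤ ∫ ω, F (openCluster ω a') ∂(prodBernoulli w)) ∧
        0 < ∑ a ∈ (A.erase k), (rankGain w (A.erase k) r' F a * avoidConst w a ((↑(((A.erase k)).erase a) : Set (Fin n)) ∪ ({d | d ∈ ([] : List (Fin n))} ∪ {k})) o +
        (∏ e ∈ Finset.univ.filter (fun e : Sym2 (Fin n) => ∃ y ∈ (↑(((A.erase k)).filter (fun b => r' b < r' a)) : Set (Fin n)), y ∈ e), (1 - (w e : ℝ))) *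
          ((∫ η in ((⋃ t ∈ (insert a (((A.erase k)).filter (fun b => r' a < r' b) ∪ (([] : List (Fin n))).toFinset)), openConn o t) ∪ openConn o k),
              F {c | c = a ∨ ∃ e ∈ openEdgeCluster η a, c ∈ e}
              ∂(prodBernoulli fun e => if (∃ y ∈ (↑(((A.erase k)).filter (fun b => r' b < r' a)) : Set (Fin n)), y ∈ e) then (0 : unitInterval) else w e)) -
            (prodBernoulli fun e => if (∃ y ∈ (↑(((A.erase k)).filter (fun b => r' b < r' a)) : Set (Fin n)), y ∈ e) then (0 : unitInterval) else w e).real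
                ((⋃ t ∈ (insert a (((A.erase k)).filter (fun b => r' a < r' b) ∪ (([] : List (Fin n))).toFinset)), openConn o t) ∪ openConn o k) *
              (∫ η, F {c | c = a ∨ ∃ e ∈ openEdgeCluster η a, c ∈ e}
                ∂(prodBernoulli fun e => if (∃ y ∈ (↑(((A.erase k)).filter (fun b => r' b < r' a)) : Set (Fin n)), y ∈ e) then (0 : unitInterval) else w e))))) ∨
      (0 < (prodBernoulli w).real ({ω : BondConfig (Fin n) | ∀ a ∈ (↑(A.erase k) : Set (Fin n)), ¬ (openGraph ω).Reachable k a} ∩ openConn o k) ∧ 0 < rankGain w A r F k) ∨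
      (∃ e ∈ E, (∀ y ∈ (↑(A.erase k) : Set (Fin n)), y ∉ e) ∧ ∃ η : Set (Sym2 (Fin n)), η ⊆ {f | f ∈ E ∧ ∀ y ∈ (↑(A.erase k) : Set (Fin n)), y ∉ f} ∧
          F (openCluster (η \ {e}) k) < F (openCluster (insert e η) k) ∧
          insert e η ∈ (openConn k o : Set (BondConfig (Fin n))) ∧ η \ {e} ∉ (openConn k o : Set (BondConfig (Fin n)))) := by
  set T : Finset (Fin n) := A.erase k with hT'
  have hTA : ∀ a ∈ T, a ∈ A := fun a ha => Finset.mem_of_mem_erase ha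
  have hkT : k ∉ T := Finset.notMem_erase k A
  have hoT : o ∉ T := fun h => hoA (hTA o h)
  have hok : o ≠ k := fun h => hoA (h ▸ hkA)
  have hrT : Set.InjOn r ↑T := hr.mono (by intro a ha; exact Finset.mem_of_mem_erase ha)
  have hcompatT : (∀ a ∈ T, ∀ a' ∈ T, r a < r a' →
        ∫ ω, F (openCluster ω a) ∂(prodBernoulli w) ≤ ∫ ω, F (openCluster ω a') ∂(prodBernoulli w)) := fun a ha a' ha' h => hcompat a (hTA a ha) a' (hTA a' ha') h
  have h3 := surplus_pos_iff_three w E hE0 hE1 A r hr k hkA hkmax o hoA F hF hF0 hcompat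
  have hS5 := s5dMargin_nil_pos_iff_exists_compat_rank_floor_pos_of_preconnected w E hE0 hE1 hconn o k hok T hT r hrT F hF hF0 hcompatT hoT hkT
  have hB := covD_clusterFun_pos_iff w E hE0 hE1 k (↑T : Set (Fin n)) o (fun h => hkT (Finset.mem_coe.1 h)) hok
    (fun h => hoT (Finset.mem_coe.1 h)) F hF
  rw [h3, hS5, hB]

/-- **The GEN ZERO SET, explicit form** (same hypotheses): `Sur_o(A) = 0` iff the explicit (S5) floor of `(A∖k; o, k)` vanishes at EVERY
compatible injective rank, AND (`μ(k ↮ A∖k, o ↔ k) = 0` or `γ_k = 0`), AND no pair of `E` missing `A∖k` is jointly pivotal inside the pairs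
of `E` missing `A∖k` for `F(C_k)` and `{k ↔ o}`.
[cite: KozmaNitzan2024, Conj. 4 (p. 32)] [cite: VandenbergHaggstromKahn2005, Thm. 1.3 (p. 6)] [cite: Harris1960, Lemma 4.1 (p. 16)] -/
theorem surplus_eq_zero_iff_certificates (w : Sym2 (Fin n) → unitInterval) (E : Set (Sym2 (Fin n)))
    (hE0 : ∀ f, f ∉ E → (w f : ℝ) = 0) (hE1 : ∀ f ∈ E, 0 < (w f : ℝ) ∧ (w f : ℝ) < 1)
    (A : Finset (Fin n)) (r : Fin n → ℕ) (hr : Set.InjOn r ↑A) (k : Fin n) (hkA : k ∈ A) (hkmax : ∀ a ∈ A, r a ≤ r k)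
    (o : Fin n) (hoA : o ∉ A)
    (F : Set (Fin n) → ℝ) (hF : ∀ S S' : Set (Fin n), S ⊆ S' → F S ≤ F S') (hF0 : ∀ S : Set (Fin n), 0 ≤ F S)
    (hcompat : ∀ a ∈ A, ∀ a' ∈ A, r a < r a' →
      ∫ ω, F (openCluster ω a) ∂(prodBernoulli w) ≤ ∫ ω, F (openCluster ω a') ∂(prodBernoulli w))
    (hconn : (openGraph E).Preconnected) (hT : (A.erase k).Nonempty) :
    surplus w A r F o = 0 ↔
      (∀ r' : Fin n → ℕ, Set.InjOn r' ↑(A.erase k) →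
        (∀ a ∈ (A.erase k), ∀ a' ∈ (A.erase k), r' a < r' a' →
        ∫ ω, F (openCluster ω a) ∂(prodBernoulli w) ≤ ∫ ω, F (openCluster ω a') ∂(prodBernoulli w)) →
        ∑ a ∈ (A.erase k), (rankGain w (A.erase k) r' F a * avoidConst w a ((↑(((A.erase k)).erase a) : Set (Fin n)) ∪ ({d | d ∈ ([] : List (Fin n))} ∪ {k})) o +
        (∏ e ∈ Finset.univ.filter (fun e : Sym2 (Fin n) => ∃ y ∈ (↑(((A.erase k)).filter (fun b => r' b < r' a)) : Set (Fin n)), y ∈ e), (1 - (w e : ℝ))) *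
          ((∫ η in ((⋃ t ∈ (insert a (((A.erase k)).filter (fun b => r' a < r' b) ∪ (([] : List (Fin n))).toFinset)), openConn o t) ∪ openConn o k),
              F {c | c = a ∨ ∃ e ∈ openEdgeCluster η a, c ∈ e}
              ∂(prodBernoulli fun e => if (∃ y ∈ (↑(((A.erase k)).filter (fun b => r' b < r' a)) : Set (Fin n)), y ∈ e) then (0 : unitInterval) else w e)) -
            (prodBernoulli fun e => if (∃ y ∈ (↑(((A.erase k)).filter (fun b => r' b < r' a)) : Set (Fin n)), y ∈ e) then (0 : unitInterval) else w e).real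
                ((⋃ t ∈ (insert a (((A.erase k)).filter (fun b => r' a < r' b) ∪ (([] : List (Fin n))).toFinset)), openConn o t) ∪ openConn o k) *
              (∫ η, F {c | c = a ∨ ∃ e ∈ openEdgeCluster η a, c ∈ e}
                ∂(prodBernoulli fun e => if (∃ y ∈ (↑(((A.erase k)).filter (fun b => r' b < r' a)) : Set (Fin n)), y ∈ e) then (0 : unitInterval) else w e)))) = 0) ∧
      ((prodBernoulli w).real ({ω : BondConfig (Fin n) | ∀ a ∈ (↑(A.erase k) : Set (Fin n)), ¬ (openGraph ω).Reachable k a} ∩ openConn o k) = 0 ∨ rankGain w A r F k = 0) ∧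
      (∀ e ∈ E, (∀ y ∈ (↑(A.erase k) : Set (Fin n)), y ∉ e) → ∀ η : Set (Sym2 (Fin n)), η ⊆ {f | f ∈ E ∧ ∀ y ∈ (↑(A.erase k) : Set (Fin n)), y ∉ f} →
          insert e η ∈ (openConn k o : Set (BondConfig (Fin n))) → η \ {e} ∉ (openConn k o : Set (BondConfig (Fin n))) →
          F (openCluster (insert e η) k) ≤ F (openCluster (η \ {e}) k)) := by
  set T : Finset (Fin n) := A.erase k with hT'
  have hTA : ∀ a ∈ T, a ∈ A := fun a ha => Finset.mem_of_mem_erase ha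
  have hkT : k ∉ T := Finset.notMem_erase k A
  have hoT : o ∉ T := fun h => hoA (hTA o h)
  have hok : o ≠ k := fun h => hoA (h ▸ hkA)
  have hrT : Set.InjOn r ↑T := hr.mono (by intro a ha; exact Finset.mem_of_mem_erase ha)
  have hcompatT : (∀ a ∈ T, ∀ a' ∈ T, r a < r a' →
        ∫ ω, F (openCluster ω a) ∂(prodBernoulli w) ≤ ∫ ω, F (openCluster ω a') ∂(prodBernoulli w)) := fun a ha a' ha' h => hcompat a (hTA a ha) a' (hTA a' ha') h
  have h3 := surplus_eq_zero_iff_three w E hE0 hE1 A r hr k hkA hkmax o hoA F hF hF0 hcompat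
  have hS5 := s5dMargin_nil_eq_zero_iff_forall_compat_rank_floor_eq_zero w E hE0 hE1 hconn o k hok T hT r hrT F hF hF0 hcompatT hoT hkT
  have hB := covD_clusterFun_pos_iff w E hE0 hE1 k (↑T : Set (Fin n)) o (fun h => hkT (Finset.mem_coe.1 h)) hok
    (fun h => hoT (Finset.mem_coe.1 h)) F hF
  obtain ⟨-, -, hcov0⟩ := surplus_pieces_nonneg w E hE0 hE1 A r hr k hkA o hoA F hF hF0 hcompat
  have hB0 : covD w k (↑T : Set (Fin n)) (fun C => F {a | a = k ∨ ∃ e ∈ C, a ∈ e}) o = 0 ↔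
      (∀ e ∈ E, (∀ y ∈ (↑T : Set (Fin n)), y ∉ e) → ∀ η : Set (Sym2 (Fin n)), η ⊆ {f | f ∈ E ∧ ∀ y ∈ (↑T : Set (Fin n)), y ∉ f} →
          insert e η ∈ (openConn k o : Set (BondConfig (Fin n))) → η \ {e} ∉ (openConn k o : Set (BondConfig (Fin n))) →
          F (openCluster (insert e η) k) ≤ F (openCluster (η \ {e}) k)) := by
    constructor
    · intro h0 e he heT η hη h1 h2
      by_contra hlt
      rw [not_le] at hlt
      have : 0 < covD w k (↑T : Set (Fin n)) (fun C => F {a | a = k ∨ ∃ e ∈ C, a ∈ e}) o := hB.2 ⟨e, he, heT, η, hη, hlt, h1, h2⟩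
      rw [h0] at this
      exact lt_irrefl _ this
    · intro hall
      rcases hcov0.lt_or_eq with hpos | hz
      · obtain ⟨e, he, heT, η, hη, hlt, h1, h2⟩ := hB.1 hpos
        exact absurd (hall e he heT η hη h1 h2) (not_le.2 hlt)
      · exact hz.symm
  rw [h3, hS5, hB0]

/-- **`|A| = 1`: the master form is a Harris covariance**, `Sur_o({k}) = Cov(F(C_k), 1{o ∈ C_k})`, and it is positive iff some pair of `E` is
jointly pivotal (at a configuration inside `E`) for `F(C_k)` and `{k ↔ o}` — the equality case of Harris' inequality for a monotone vertex
functional against a connection. [cite: Harris1960, Lemma 4.1 (p. 16)] [cite: VandenbergHaggstromKahn2005, Thm. 1.3 (p. 6)] -/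
theorem surplus_singleton_pos_iff (w : Sym2 (Fin n) → unitInterval) (E : Set (Sym2 (Fin n)))
    (hE0 : ∀ f, f ∉ E → (w f : ℝ) = 0) (hE1 : ∀ f ∈ E, 0 < (w f : ℝ) ∧ (w f : ℝ) < 1)
    (r : Fin n → ℕ) (k o : Fin n) (hok : o ≠ k)
    (F : Set (Fin n) → ℝ) (hF : ∀ S S' : Set (Fin n), S ⊆ S' → F S ≤ F S') (hF0 : ∀ S : Set (Fin n), 0 ≤ F S) :
    0 < surplus w {k} r F o ↔
      ∃ e ∈ E, ∃ η : Set (Sym2 (Fin n)), η ⊆ E ∧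
        F (openCluster (η \ {e}) k) < F (openCluster (insert e η) k) ∧
        insert e η ∈ (openConn k o : Set (BondConfig (Fin n))) ∧ η \ {e} ∉ (openConn k o : Set (BondConfig (Fin n))) := by
  have hkA : k ∈ ({k} : Finset (Fin n)) := Finset.mem_singleton_self k
  have hoA : o ∉ ({k} : Finset (Fin n)) := fun h => hok (Finset.mem_singleton.1 h)
  have hr : Set.InjOn r ↑({k} : Finset (Fin n)) := by
    intro a ha b hb _
    rw [Finset.coe_singleton, mem_singleton_iff] at ha hb
    rw [ha, hb]
  have hkmax : ∀ a ∈ ({k} : Finset (Fin n)), r a ≤ r k := fun a ha => by rw [Finset.mem_singleton.1 ha]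
  have hcompat : ∀ a ∈ ({k} : Finset (Fin n)), ∀ a' ∈ ({k} : Finset (Fin n)), r a < r a' →
      ∫ ω, F (openCluster ω a) ∂(prodBernoulli w) ≤ ∫ ω, F (openCluster ω a') ∂(prodBernoulli w) := by
    intro a ha a' ha' h
    rw [Finset.mem_singleton.1 ha, Finset.mem_singleton.1 ha'] at h
    exact absurd h (lt_irrefl _)
  have h3 := surplus_pos_iff_three w E hE0 hE1 {k} r hr k hkA hkmax o hoA F hF hF0 hcompat
  have hT0 : ({k} : Finset (Fin n)).erase k = ∅ := by simp
  have hs5 : s5dMargin w (({k} : Finset (Fin n)).erase k) r [] o k F = 0 := by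
    rw [hT0, s5dMargin_nil]
    simp [surplus]
  have hγ : rankGain w {k} r F k = 0 := by
    unfold rankGain
    refine Finset.sum_eq_zero fun a' ha' => ?_
    obtain ⟨ha', hlt⟩ := Finset.mem_filter.1 ha'
    rw [Finset.mem_singleton.1 ha'] at hlt
    exact absurd hlt (lt_irrefl _)
  have hB := covD_clusterFun_pos_iff w E hE0 hE1 k (↑(({k} : Finset (Fin n)).erase k) : Set (Fin n)) o
    (by rw [hT0]; simp) hok (by rw [hT0]; simp) F hF
  rw [h3, hs5, hγ, hB]
  constructor
  · rintro (h | ⟨_, h⟩ | ⟨e, he, -, η, hη, h⟩)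
    · exact absurd h (lt_irrefl _)
    · exact absurd h (lt_irrefl _)
    · exact ⟨e, he, η, fun f hf => (hη hf).1, h⟩
  · rintro ⟨e, he, η, hη, h⟩
    refine Or.inr (Or.inr ⟨e, he, fun y hy => ?_, η, fun f hf => ⟨hη hf, fun y hy => ?_⟩, h⟩)
    · rw [hT0] at hy; simp at hy
    · rw [hT0] at hy; simp at hy

end CSH

end Summit.CriticalPhenomena.PercolationContinuityZ3.Theorems

end
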